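import Mathlib

/-!
# NegationLens6g13 — algebraic cores of LEMMA S / Δ7 (memo `NEGATION-lens6-g13.md`, §1–§2)

unit res-B-lens-6 g13 · crux stmt-ResolutionOfSingularities-0549 `Theses.Descent.DescentPerfectToAll` ·
bears_on: LADDER-RESOLUTION:B · [OURS · CANDIDATE] counted 0 · **nothing in this file proves resolution of
singularities in positive characteristic**, and nothing here touches the statement, rank or glue of 0549.

The memo's LEMMA S says that a line created by a point blow-up at a non-event leaf-carrying chain point is
sterile; its content is three facts about the dehomogenised initial form `s^λ (α + β s)`:

* `K17_*` — case (b1): `R(s) = c·(α + β s)` has constant derivative `c·β ≠ 0`, hence no critical point.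
* `K18_*` — case (b2): `P(s) = s^{m+1}(α + β s)` has `P′(s) = s^{m}((m+1)α + (m+2)β s)`; the root `s_c` of the
  linear factor is `≠ 0`, differs from the trace crossing (`α + β s_c ≠ 0`), and is a SIMPLE critical point
  (`s_c·P″(s_c) = −(m+1)·α·s_c^{m} ≠ 0`).
* `K19_*` — Δ7 (EVENT test): the one-variable Frobenius coefficient law in characteristic `p` and its uses:
  `X^b(α + βX)` with `α, β ≠ 0` is never a `p`-th power; `α X^b = f^p` forces `p ∣ b`; and the degree
  bookkeeping `p ∣ a+b+1 ∧ p ∣ b → p ∣ a+1` (a `p`-th power FORM `u^a v^b (αu+βv)` needs both).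
* `K20`   — the residue walk of Corollary S′ (i): `(r mod p) + 1 = p ↔ r ≡ −1 (mod p)`.

Mathlib only; no `sorry`.
-/

set_option linter.dupNamespace false

namespace Summit.ResolutionOfSingularities.ResolutionOfSingularities.Cruxes.DescentPerfectToAll.NegationLens6g13

open Polynomial

/-! ### K17: the free uncharged run line (memo 2.3 (b1)) -/
section K17
variable {K : Type*} [Field K]

/-- K17a: the formal derivative of `c·(α + β·X)` is the constant `c·β`. -/
theorem K17_derivative (c α β : K) :
    derivative (C c * (C α + C β * X)) = C (c * β) := by
  simp [derivative_mul]

/-- K17b: hence it has no root when `c ≠ 0`, `β ≠ 0`: a (b1) line has `Π ≡ 1` and never bears. -/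
theorem K17_no_critical_point (c α β s : K) (hc : c ≠ 0) (hβ : β ≠ 0) :
    ¬ (derivative (C c * (C α + C β * X))).IsRoot s := by
  rw [K17_derivative, IsRoot, eval_C]
  exact mul_ne_zero hc hβ

end K17

/-! ### K18: the corner uncharged run line (memo 2.3 (b2)); `λ₂ = m + 1 ≥ 1` -/
section K18
variable {K : Type*} [Field K]

/-- K18a (ring identity): `P′(s) = (m+1)α s^m + (m+2)β s^{m+1} = s^m·((m+1)α + (m+2)β s)` for `P = s^{m+1}(α+βs)`. -/
theorem K18_factor (α β s : K) (m : ℕ) :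
    (m + 1 : K) * α * s ^ m + (m + 2 : K) * β * s ^ (m + 1)
      = s ^ m * ((m + 1 : K) * α + (m + 2 : K) * β * s) := by
  ring

/-- K18b: the linear factor vanishes at `s` iff `s·((m+2)β) = −(m+1)α` (so `s = s_c := −(m+1)α/((m+2)β)` when `(m+2)β ≠ 0`). -/
theorem K18_critical_value (α β s : K) (m : ℕ) :
    (m + 1 : K) * α + (m + 2 : K) * β * s = 0 ↔ s * ((m + 2 : K) * β) = -((m + 1 : K) * α) := by
  constructor <;> intro h <;> linear_combination h

/-- K18c: the critical value is non-zero (`α ≠ 0`, `λ₂ = m+1 ≢ 0`). -/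
theorem K18_critical_ne_zero (α β s : K) (m : ℕ) (hα : α ≠ 0) (h1 : (m + 1 : K) ≠ 0)
    (h : (m + 1 : K) * α + (m + 2 : K) * β * s = 0) : s ≠ 0 := by
  rintro rfl
  apply mul_ne_zero h1 hα
  simpa using h

/-- K18d: the critical point is not the trace crossing: `α + β s_c ≠ 0` (`α, β ≠ 0`). -/
theorem K18_critical_ne_crossing (α β s : K) (m : ℕ) (hα : α ≠ 0) (hβ : β ≠ 0)
    (h : (m + 1 : K) * α + (m + 2 : K) * β * s = 0) : α + β * s ≠ 0 := by
  intro h0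
  have hbs : β * s = 0 := by linear_combination h - (m + 1 : K) * h0
  rcases mul_eq_zero.mp hbs with hb | hs
  · exact hβ hb
  · subst hs
    apply hα
    simpa using h0

/-- K18e: at a critical point, `s·P″(s) = −(m+1)·α·s^m` (so the critical point is SIMPLE when `(m+1)α s ≠ 0`). -/
theorem K18_second_derivative (α β s : K) (m : ℕ)
    (h : (m + 1 : K) * α + (m + 2 : K) * β * s = 0) :
    (m + 1 : K) * (m : K) * α * s ^ m + (m + 2 : K) * (m + 1 : K) * β * s ^ (m + 1)
      = -((m + 1 : K) * α * s ^ m) := by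
  linear_combination ((m + 1 : K) * s ^ m) * h

/-- K18f: … and that value is non-zero: `Π_{e_z}(s_c) = 2` exactly. -/
theorem K18_simple (α β s : K) (m : ℕ) (hα : α ≠ 0) (h1 : (m + 1 : K) ≠ 0)
    (h : (m + 1 : K) * α + (m + 2 : K) * β * s = 0) :
    (m + 1 : K) * (m : K) * α * s ^ m + (m + 2 : K) * (m + 1 : K) * β * s ^ (m + 1) ≠ 0 := by
  rw [K18_second_derivative α β s m h]
  exact neg_ne_zero.mpr (mul_ne_zero (mul_ne_zero h1 hα) (pow_ne_zero _ (K18_critical_ne_zero α β s m hα h1 h)))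

end K18

/-! ### K19: the EVENT test (memo Δ7) — Frobenius coefficient law and «not a p-th power» -/
section K19
variable {S : Type*} [CommRing S] (p : ℕ) [hp : Fact p.Prime] [CharP S p]

/-- K19a: in characteristic `p`, `(b^p).coeff n = (b.coeff (n/p))^p` if `p ∣ n`, else `0`. -/
theorem K19_coeff_pow_p (b : S[X]) (n : ℕ) :
    (b ^ p).coeff n = if p ∣ n then (b.coeff (n / p)) ^ p else 0 := by
  rw [← Polynomial.map_frobenius_expand (p := p), Polynomial.coeff_map,
    Polynomial.coeff_expand hp.out.pos]
  by_cases h : p ∣ n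
  · rw [if_pos h, if_pos h, frobenius_def]
  · rw [if_neg h, if_neg h, map_zero]

/-- K19b: a `p`-th power has no coefficient at exponents `≢ 0 (mod p)`. -/
theorem K19_coeff_eq_zero_of_not_dvd (b : S[X]) {n : ℕ} (hn : ¬ p ∣ n) : (b ^ p).coeff n = 0 := by
  rw [K19_coeff_pow_p p, if_neg hn]

/-- K19c (transversal case of Δ7): `α X^b + β X^{b+1}` with `α, β ≠ 0` is never a `p`-th power
(`p ∣ b` and `p ∣ b+1` cannot both hold). -/
theorem K19_transversal_not_pth_power (α β : S) (hα : α ≠ 0) (hβ : β ≠ 0) (b : ℕ) (f : S[X]) :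
    C α * X ^ b + C β * X ^ (b + 1) ≠ f ^ p := by
  intro h
  by_cases hb : p ∣ b
  · have hb1 : ¬ p ∣ b + 1 := by
      intro h'
      have : p ∣ 1 := (Nat.dvd_add_right hb).mp h'
      exact hp.out.one_lt.ne' (Nat.dvd_one.mp this)
    have := congrArg (fun q : S[X] => q.coeff (b + 1)) h
    simp only [coeff_add, coeff_C_mul, coeff_X_pow] at this
    rw [K19_coeff_eq_zero_of_not_dvd p f hb1] at this
    simp at this
    exact hβ this
  · have := congrArg (fun q : S[X] => q.coeff b) h
    simp only [coeff_add, coeff_C_mul, coeff_X_pow] at this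
    rw [K19_coeff_eq_zero_of_not_dvd p f hb] at this
    simp at this
    exact hα this

/-- K19d (tangent case of Δ7): `α X^b = f^p` with `α ≠ 0` forces `p ∣ b`. -/
theorem K19_tangent_dvd (α : S) (hα : α ≠ 0) (b : ℕ) (f : S[X]) (h : C α * X ^ b = f ^ p) : p ∣ b := by
  by_contra hb
  have := congrArg (fun q : S[X] => q.coeff b) h
  simp only [coeff_C_mul, coeff_X_pow] at this
  rw [K19_coeff_eq_zero_of_not_dvd p f hb] at this
  simp at this
  exact hα this

/-- K19e (degree bookkeeping): a `p`-th power FORM `u^a v^b·(αu)` has `p ∣ a+b+1` (degree) and `p ∣ b`,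
hence `p ∣ a+1`: the event residues `(a, b) ≡ (−1, 0)`. -/
theorem K19_event_residues (a b q : ℕ) (h1 : q ∣ a + b + 1) (h2 : q ∣ b) : q ∣ a + 1 := by
  have h3 : a + b + 1 = b + (a + 1) := by ring
  rw [h3] at h1
  exact (Nat.dvd_add_right h2).mp h1

end K19

/-! ### K20: the residue walk of Corollary S′ (i) -/

/-- K20: along a transversal run `ρ(x_i) = (ρ(x_{i-1}) mod p) + 1`; it equals `p` iff the previous residue is `p − 1`. -/
theorem K20_residue_walk (r p : ℕ) (hp : 1 ≤ p) : r % p + 1 = p ↔ r % p = p - 1 := by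
  omega

end Summit.ResolutionOfSingularities.ResolutionOfSingularities.Cruxes.DescentPerfectToAll.NegationLens6g13
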